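import Mathlib
import HarnessLib
import Summits.HubbardSuperconductivity.HubbardSuperconductivity.Theorems.WeakCouplingBCSKlCertTPrimePocketFrame

/-!
# Route `WeakCouplingBCS` — certificate half of stmt-HubbardSuperconductivity-0158, item (N3)′ of «TPRIME-LINDHARD-HS» (pen (R475)(A)), file F2a:
# the PAIR ENERGY `G(θ, φ) = ε_{t′}(p + γ(θ) + γ(φ)) − μ` along the Γ-centred polar chart `γ = kltpPolar tp μ` and its slice derivatives

Cell `gate-hubbard-kl`, seat p4 (g24); zero kit.  The `t′`-twin of `Literature…HubbardPairEnergy` (written for `t′ = 0` and the closed-form chart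
`bandX/Y`), for the implicit chart of `…KlCertTPrimePocketFrame` (frame `kltpX/Y`, velocity `kltpVX/VY`, acceleration `kltpAX/AY`) at FIXED
`(t′, μ)` on the Γ-window `|t′| < 1/2`, `−4 − 4t′ < μ < 4t′`.  With `X = p₁ + x(θ) + x(φ)`, `Y = p₂ + y(θ) + y(φ)` and the partials
`ε_x, ε_y, ε_xx, ε_xy, ε_yy` of `ε_{t′}` (`KlTPrimeConvexity.dx … dyy`, the `cos·cos` cross term included):

* the six quantities `G`, `∂_θG`, `∂_φG`, `∂²_θG`, `∂²_φG`, `∂_θ∂_φG` and the diagonal second derivative `(∂_θ + ∂_φ)²G` (definitions with bodies);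
* the `HasDerivAt` statements along `θ`-slices, `φ`-slices and diagonal slices `u ↦ G(w + u, u)`;
* joint continuity in `(p, θ, φ)`; `2π`-periodicity in `p` and the reduction of `p` into `[−π, π]²`;
* the bridge `squareDispersion 1 tp (p + (kltpPolar tp μ θ + kltpPolar tp μ φ)) − μ = kltpPairE tp μ (p 0, p 1) θ φ`.

The six-quantity NONDEGENERACY is in the companion `…KlCertTPrimePairEnergyNondegenerate`.  Honest framing: calculus of one explicit
trigonometric function; nothing here asserts (N3)′, an HS row, a margin, `K₃`, `U₀`, the window or superconductivity; a Kohn–Luttinger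
`O(U²)` channel statement is not ODLRO; nothing here proves superconductivity in the Hubbard model.
References: S. Raghu, S. A. Kivelson, D. J. Scalapino, Phys. Rev. B 81 (2010) 224505, §II (5); E. M. Stein, *Harmonic Analysis* (1993),
Ch. VIII §1 (sublevel sets and van der Corput).
-/

noncomputable section

-- the tree's namespace `Summit.<Summit>.<Problem>.Theorems` repeats the summit name by design (D-0017)
set_option linter.dupNamespace false

namespace Summit.HubbardSuperconductivity.HubbardSuperconductivity.Theorems

open Real Set Filter Literature.MathematicalPhysics.QuantumLattice KlTPrimeConvexity
open scoped Topology

/-! ### Definitions -/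

/-- First coordinate of the pair momentum `p + γ(θ) + γ(φ)`. [folklore] -/
def kltpPairKX (tp μ : ℝ) (p : ℝ × ℝ) (θ φ : ℝ) : ℝ := p.1 + kltpX tp μ θ + kltpX tp μ φ

/-- Second coordinate of the pair momentum `p + γ(θ) + γ(φ)`. [folklore] -/
def kltpPairKY (tp μ : ℝ) (p : ℝ × ℝ) (θ φ : ℝ) : ℝ := p.2 + kltpY tp μ θ + kltpY tp μ φ

/-- **The pair energy** `G(θ, φ) = ε_{t′}(p + γ(θ) + γ(φ)) − μ`. [folklore] -/
def kltpPairE (tp μ : ℝ) (p : ℝ × ℝ) (θ φ : ℝ) : ℝ :=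
  -2 * 1 * (Real.cos (kltpPairKX tp μ p θ φ) + Real.cos (kltpPairKY tp μ p θ φ)) -
    4 * tp * Real.cos (kltpPairKX tp μ p θ φ) * Real.cos (kltpPairKY tp μ p θ φ) - μ

/-- `∂_θ G = ε_x(X,Y)·x′(θ) + ε_y(X,Y)·y′(θ)`. [folklore] -/
def kltpPairE₁ (tp μ : ℝ) (p : ℝ × ℝ) (θ φ : ℝ) : ℝ :=
  dx tp (kltpPairKX tp μ p θ φ) (kltpPairKY tp μ p θ φ) * kltpVX tp μ θ +
    dy tp (kltpPairKX tp μ p θ φ) (kltpPairKY tp μ p θ φ) * kltpVY tp μ θ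

/-- `∂_φ G = ε_x(X,Y)·x′(φ) + ε_y(X,Y)·y′(φ)`. [folklore] -/
def kltpPairE₂ (tp μ : ℝ) (p : ℝ × ℝ) (θ φ : ℝ) : ℝ :=
  dx tp (kltpPairKX tp μ p θ φ) (kltpPairKY tp μ p θ φ) * kltpVX tp μ φ +
    dy tp (kltpPairKX tp μ p θ φ) (kltpPairKY tp μ p θ φ) * kltpVY tp μ φ

/-- `∂²_θ G`. [folklore] -/
def kltpPairE₁₁ (tp μ : ℝ) (p : ℝ × ℝ) (θ φ : ℝ) : ℝ :=
  dxx tp (kltpPairKX tp μ p θ φ) (kltpPairKY tp μ p θ φ) * kltpVX tp μ θ ^ 2 +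
    2 * dxy tp (kltpPairKX tp μ p θ φ) (kltpPairKY tp μ p θ φ) * kltpVX tp μ θ * kltpVY tp μ θ +
    dyy tp (kltpPairKX tp μ p θ φ) (kltpPairKY tp μ p θ φ) * kltpVY tp μ θ ^ 2 +
    (dx tp (kltpPairKX tp μ p θ φ) (kltpPairKY tp μ p θ φ) * kltpAX tp μ θ +
      dy tp (kltpPairKX tp μ p θ φ) (kltpPairKY tp μ p θ φ) * kltpAY tp μ θ)

/-- `∂²_φ G`. [folklore] -/
def kltpPairE₂₂ (tp μ : ℝ) (p : ℝ × ℝ) (θ φ : ℝ) : ℝ :=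
  dxx tp (kltpPairKX tp μ p θ φ) (kltpPairKY tp μ p θ φ) * kltpVX tp μ φ ^ 2 +
    2 * dxy tp (kltpPairKX tp μ p θ φ) (kltpPairKY tp μ p θ φ) * kltpVX tp μ φ * kltpVY tp μ φ +
    dyy tp (kltpPairKX tp μ p θ φ) (kltpPairKY tp μ p θ φ) * kltpVY tp μ φ ^ 2 +
    (dx tp (kltpPairKX tp μ p θ φ) (kltpPairKY tp μ p θ φ) * kltpAX tp μ φ +
      dy tp (kltpPairKX tp μ p θ φ) (kltpPairKY tp μ p θ φ) * kltpAY tp μ φ)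

/-- `∂_θ∂_φ G` (no acceleration terms: the two angles enter the pair momentum additively). [folklore] -/
def kltpPairE₁₂ (tp μ : ℝ) (p : ℝ × ℝ) (θ φ : ℝ) : ℝ :=
  dxx tp (kltpPairKX tp μ p θ φ) (kltpPairKY tp μ p θ φ) * kltpVX tp μ θ * kltpVX tp μ φ +
    dxy tp (kltpPairKX tp μ p θ φ) (kltpPairKY tp μ p θ φ) * (kltpVX tp μ θ * kltpVY tp μ φ + kltpVX tp μ φ * kltpVY tp μ θ) +
    dyy tp (kltpPairKX tp μ p θ φ) (kltpPairKY tp μ p θ φ) * kltpVY tp μ θ * kltpVY tp μ φ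

/-- The diagonal second derivative `(∂_θ + ∂_φ)² G = ∂²_θG + 2∂_θ∂_φG + ∂²_φG`. [folklore] -/
def kltpPairEdd (tp μ : ℝ) (p : ℝ × ℝ) (θ φ : ℝ) : ℝ :=
  kltpPairE₁₁ tp μ p θ φ + 2 * kltpPairE₁₂ tp μ p θ φ + kltpPairE₂₂ tp μ p θ φ

/-! ### The bridge to `squareDispersion` along `kltpPolar` -/

/-- `ε_{t′}(p + γ(θ) + γ(φ)) − μ = kltpPairE tp μ (p₀, p₁) θ φ`. [folklore] -/
theorem squareDispersion_pair_eq_kltpPairE (tp μ : ℝ) (p : Momentum) (θ φ : ℝ) :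
    squareDispersion 1 tp (p + (kltpPolar tp μ θ + kltpPolar tp μ φ)) - μ = kltpPairE tp μ (p 0, p 1) θ φ := by
  simp only [squareDispersion, kltpPairE, kltpPairKX, kltpPairKY, PiLp.add_apply, kltpPolar_apply_zero', kltpPolar_apply_one',
    add_assoc]

section Window

variable {tp μ : ℝ} (htp : |tp| < 1 / 2) (hμ₁ : -4 - 4 * tp < μ) (hμ₂ : μ < 4 * tp)
include htp hμ₁ hμ₂

/-! ### Slice derivatives -/

/-- `θ`-slice: `∂_θ G = kltpPairE₁`. [folklore] -/
theorem hasDerivAt_kltpPairE_fst (p : ℝ × ℝ) (θ φ : ℝ) :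
    HasDerivAt (fun t => kltpPairE tp μ p t φ) (kltpPairE₁ tp μ p θ φ) θ := by
  have hX : HasDerivAt (fun t => kltpPairKX tp μ p t φ) (kltpVX tp μ θ) θ := by
    have h := ((hasDerivAt_kltpX htp hμ₁ hμ₂ θ).const_add p.1).add_const (kltpX tp μ φ)
    exact h
  have hY : HasDerivAt (fun t => kltpPairKY tp μ p t φ) (kltpVY tp μ θ) θ := by
    have h := ((hasDerivAt_kltpY htp hμ₁ hμ₂ θ).const_add p.2).add_const (kltpY tp μ φ)
    exact h
  have h := (((hX.cos.add hY.cos).const_mul (-2 * 1)).sub ((hX.cos.const_mul (4 * tp)).mul hY.cos)).sub_const μ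
  refine h.congr_deriv ?_
  simp only [kltpPairE₁, dx, dy]; ring

/-- `θ`-slice: `∂_θ kltpPairE₁ = kltpPairE₁₁`. [folklore] -/
theorem hasDerivAt_kltpPairE₁_fst (p : ℝ × ℝ) (θ φ : ℝ) :
    HasDerivAt (fun t => kltpPairE₁ tp μ p t φ) (kltpPairE₁₁ tp μ p θ φ) θ := by
  have hX : HasDerivAt (fun t => kltpPairKX tp μ p t φ) (kltpVX tp μ θ) θ := by
    have h := ((hasDerivAt_kltpX htp hμ₁ hμ₂ θ).const_add p.1).add_const (kltpX tp μ φ)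
    exact h
  have hY : HasDerivAt (fun t => kltpPairKY tp μ p t φ) (kltpVY tp μ θ) θ := by
    have h := ((hasDerivAt_kltpY htp hμ₁ hμ₂ θ).const_add p.2).add_const (kltpY tp μ φ)
    exact h
  have hdx : HasDerivAt (fun t => 2 * Real.sin (kltpPairKX tp μ p t φ) * (1 + 2 * tp * Real.cos (kltpPairKY tp μ p t φ)))
      (2 * (Real.cos (kltpPairKX tp μ p θ φ) * kltpVX tp μ θ) * (1 + 2 * tp * Real.cos (kltpPairKY tp μ p θ φ)) +
        2 * Real.sin (kltpPairKX tp μ p θ φ) * (2 * tp * (-Real.sin (kltpPairKY tp μ p θ φ) * kltpVY tp μ θ))) θ :=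
    (hX.sin.const_mul 2).mul ((hY.cos.const_mul (2 * tp)).const_add 1)
  have hdy : HasDerivAt (fun t => 2 * Real.sin (kltpPairKY tp μ p t φ) * (1 + 2 * tp * Real.cos (kltpPairKX tp μ p t φ)))
      (2 * (Real.cos (kltpPairKY tp μ p θ φ) * kltpVY tp μ θ) * (1 + 2 * tp * Real.cos (kltpPairKX tp μ p θ φ)) +
        2 * Real.sin (kltpPairKY tp μ p θ φ) * (2 * tp * (-Real.sin (kltpPairKX tp μ p θ φ) * kltpVX tp μ θ))) θ :=
    (hY.sin.const_mul 2).mul ((hX.cos.const_mul (2 * tp)).const_add 1)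
  have h := (hdx.mul (hasDerivAt_kltpVX htp hμ₁ hμ₂ θ)).add (hdy.mul (hasDerivAt_kltpVY htp hμ₁ hμ₂ θ))
  have hfun : (fun t => kltpPairE₁ tp μ p t φ) = fun t =>
      2 * Real.sin (kltpPairKX tp μ p t φ) * (1 + 2 * tp * Real.cos (kltpPairKY tp μ p t φ)) * kltpVX tp μ t +
        2 * Real.sin (kltpPairKY tp μ p t φ) * (1 + 2 * tp * Real.cos (kltpPairKX tp μ p t φ)) * kltpVY tp μ t := by
    funext t; simp only [kltpPairE₁, dx, dy]
  rw [hfun]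
  refine h.congr_deriv ?_
  simp only [kltpPairE₁₁, dx, dy, dxx, dyy, dxy]; ring

/-- `φ`-slice: `∂_φ G = kltpPairE₂`. [folklore] -/
theorem hasDerivAt_kltpPairE_snd (p : ℝ × ℝ) (θ φ : ℝ) :
    HasDerivAt (fun t => kltpPairE tp μ p θ t) (kltpPairE₂ tp μ p θ φ) φ := by
  have hX : HasDerivAt (fun t => kltpPairKX tp μ p θ t) (kltpVX tp μ φ) φ := by
    have h := (hasDerivAt_kltpX htp hμ₁ hμ₂ φ).const_add (p.1 + kltpX tp μ θ)
    exact h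
  have hY : HasDerivAt (fun t => kltpPairKY tp μ p θ t) (kltpVY tp μ φ) φ := by
    have h := (hasDerivAt_kltpY htp hμ₁ hμ₂ φ).const_add (p.2 + kltpY tp μ θ)
    exact h
  have h := (((hX.cos.add hY.cos).const_mul (-2 * 1)).sub ((hX.cos.const_mul (4 * tp)).mul hY.cos)).sub_const μ
  refine h.congr_deriv ?_
  simp only [kltpPairE₂, dx, dy]; ring

/-- `φ`-slice: `∂_φ kltpPairE₂ = kltpPairE₂₂`. [folklore] -/
theorem hasDerivAt_kltpPairE₂_snd (p : ℝ × ℝ) (θ φ : ℝ) :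
    HasDerivAt (fun t => kltpPairE₂ tp μ p θ t) (kltpPairE₂₂ tp μ p θ φ) φ := by
  have hX : HasDerivAt (fun t => kltpPairKX tp μ p θ t) (kltpVX tp μ φ) φ := by
    have h := (hasDerivAt_kltpX htp hμ₁ hμ₂ φ).const_add (p.1 + kltpX tp μ θ)
    exact h
  have hY : HasDerivAt (fun t => kltpPairKY tp μ p θ t) (kltpVY tp μ φ) φ := by
    have h := (hasDerivAt_kltpY htp hμ₁ hμ₂ φ).const_add (p.2 + kltpY tp μ θ)
    exact h
  have hdx : HasDerivAt (fun t => 2 * Real.sin (kltpPairKX tp μ p θ t) * (1 + 2 * tp * Real.cos (kltpPairKY tp μ p θ t)))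
      (2 * (Real.cos (kltpPairKX tp μ p θ φ) * kltpVX tp μ φ) * (1 + 2 * tp * Real.cos (kltpPairKY tp μ p θ φ)) +
        2 * Real.sin (kltpPairKX tp μ p θ φ) * (2 * tp * (-Real.sin (kltpPairKY tp μ p θ φ) * kltpVY tp μ φ))) φ :=
    (hX.sin.const_mul 2).mul ((hY.cos.const_mul (2 * tp)).const_add 1)
  have hdy : HasDerivAt (fun t => 2 * Real.sin (kltpPairKY tp μ p θ t) * (1 + 2 * tp * Real.cos (kltpPairKX tp μ p θ t)))
      (2 * (Real.cos (kltpPairKY tp μ p θ φ) * kltpVY tp μ φ) * (1 + 2 * tp * Real.cos (kltpPairKX tp μ p θ φ)) +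
        2 * Real.sin (kltpPairKY tp μ p θ φ) * (2 * tp * (-Real.sin (kltpPairKX tp μ p θ φ) * kltpVX tp μ φ))) φ :=
    (hY.sin.const_mul 2).mul ((hX.cos.const_mul (2 * tp)).const_add 1)
  have h := (hdx.mul (hasDerivAt_kltpVX htp hμ₁ hμ₂ φ)).add (hdy.mul (hasDerivAt_kltpVY htp hμ₁ hμ₂ φ))
  have hfun : (fun t => kltpPairE₂ tp μ p θ t) = fun t =>
      2 * Real.sin (kltpPairKX tp μ p θ t) * (1 + 2 * tp * Real.cos (kltpPairKY tp μ p θ t)) * kltpVX tp μ t +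
        2 * Real.sin (kltpPairKY tp μ p θ t) * (1 + 2 * tp * Real.cos (kltpPairKX tp μ p θ t)) * kltpVY tp μ t := by
    funext t; simp only [kltpPairE₂, dx, dy]
  rw [hfun]
  refine h.congr_deriv ?_
  simp only [kltpPairE₂₂, dx, dy, dxx, dyy, dxy]; ring

/-- Diagonal slice: `d/du G(w + u, u) = kltpPairE₁ + kltpPairE₂`. [folklore] -/
theorem hasDerivAt_kltpPairE_diag (p : ℝ × ℝ) (w u : ℝ) :
    HasDerivAt (fun t => kltpPairE tp μ p (w + t) t) (kltpPairE₁ tp μ p (w + u) u + kltpPairE₂ tp μ p (w + u) u) u := by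
  have hxw : HasDerivAt (fun t => kltpX tp μ (w + t)) (kltpVX tp μ (w + u)) u := by
    have h := (hasDerivAt_kltpX htp hμ₁ hμ₂ (w + u)).comp_const_add w u
    exact h
  have hyw : HasDerivAt (fun t => kltpY tp μ (w + t)) (kltpVY tp μ (w + u)) u := by
    have h := (hasDerivAt_kltpY htp hμ₁ hμ₂ (w + u)).comp_const_add w u
    exact h
  have hX : HasDerivAt (fun t => kltpPairKX tp μ p (w + t) t) (kltpVX tp μ (w + u) + kltpVX tp μ u) u := by
    have h := (hxw.const_add p.1).add (hasDerivAt_kltpX htp hμ₁ hμ₂ u)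
    exact h
  have hY : HasDerivAt (fun t => kltpPairKY tp μ p (w + t) t) (kltpVY tp μ (w + u) + kltpVY tp μ u) u := by
    have h := (hyw.const_add p.2).add (hasDerivAt_kltpY htp hμ₁ hμ₂ u)
    exact h
  have h := (((hX.cos.add hY.cos).const_mul (-2 * 1)).sub ((hX.cos.const_mul (4 * tp)).mul hY.cos)).sub_const μ
  refine h.congr_deriv ?_
  simp only [kltpPairE₁, kltpPairE₂, dx, dy]; ring

/-- Diagonal slice: `d/du (kltpPairE₁ + kltpPairE₂)(w + u, u) = kltpPairEdd`. [folklore] -/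
theorem hasDerivAt_kltpPairE₁₂_diag (p : ℝ × ℝ) (w u : ℝ) :
    HasDerivAt (fun t => kltpPairE₁ tp μ p (w + t) t + kltpPairE₂ tp μ p (w + t) t) (kltpPairEdd tp μ p (w + u) u) u := by
  have hxw : HasDerivAt (fun t => kltpX tp μ (w + t)) (kltpVX tp μ (w + u)) u := by
    have h := (hasDerivAt_kltpX htp hμ₁ hμ₂ (w + u)).comp_const_add w u
    exact h
  have hyw : HasDerivAt (fun t => kltpY tp μ (w + t)) (kltpVY tp μ (w + u)) u := by
    have h := (hasDerivAt_kltpY htp hμ₁ hμ₂ (w + u)).comp_const_add w u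
    exact h
  have hvxw : HasDerivAt (fun t => kltpVX tp μ (w + t)) (kltpAX tp μ (w + u)) u := by
    have h := (hasDerivAt_kltpVX htp hμ₁ hμ₂ (w + u)).comp_const_add w u
    exact h
  have hvyw : HasDerivAt (fun t => kltpVY tp μ (w + t)) (kltpAY tp μ (w + u)) u := by
    have h := (hasDerivAt_kltpVY htp hμ₁ hμ₂ (w + u)).comp_const_add w u
    exact h
  have hX : HasDerivAt (fun t => kltpPairKX tp μ p (w + t) t) (kltpVX tp μ (w + u) + kltpVX tp μ u) u := by
    have h := (hxw.const_add p.1).add (hasDerivAt_kltpX htp hμ₁ hμ₂ u)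
    exact h
  have hY : HasDerivAt (fun t => kltpPairKY tp μ p (w + t) t) (kltpVY tp μ (w + u) + kltpVY tp μ u) u := by
    have h := (hyw.const_add p.2).add (hasDerivAt_kltpY htp hμ₁ hμ₂ u)
    exact h
  -- `G₁ + G₂ = ε_x(X,Y)·(x′(w+u) + x′(u)) + ε_y(X,Y)·(y′(w+u) + y′(u))`
  have hsum : (fun t => kltpPairE₁ tp μ p (w + t) t + kltpPairE₂ tp μ p (w + t) t) = fun t =>
      2 * Real.sin (kltpPairKX tp μ p (w + t) t) * (1 + 2 * tp * Real.cos (kltpPairKY tp μ p (w + t) t)) *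
          (kltpVX tp μ (w + t) + kltpVX tp μ t) +
        2 * Real.sin (kltpPairKY tp μ p (w + t) t) * (1 + 2 * tp * Real.cos (kltpPairKX tp μ p (w + t) t)) *
          (kltpVY tp μ (w + t) + kltpVY tp μ t) := by
    funext t; simp only [kltpPairE₁, kltpPairE₂, dx, dy]; ring
  rw [hsum]
  have hsx : HasDerivAt (fun t => kltpVX tp μ (w + t) + kltpVX tp μ t) (kltpAX tp μ (w + u) + kltpAX tp μ u) u :=
    hvxw.add (hasDerivAt_kltpVX htp hμ₁ hμ₂ u)
  have hsy : HasDerivAt (fun t => kltpVY tp μ (w + t) + kltpVY tp μ t) (kltpAY tp μ (w + u) + kltpAY tp μ u) u :=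
    hvyw.add (hasDerivAt_kltpVY htp hμ₁ hμ₂ u)
  have hdx : HasDerivAt (fun t => 2 * Real.sin (kltpPairKX tp μ p (w + t) t) * (1 + 2 * tp * Real.cos (kltpPairKY tp μ p (w + t) t)))
      (2 * (Real.cos (kltpPairKX tp μ p (w + u) u) * (kltpVX tp μ (w + u) + kltpVX tp μ u)) *
          (1 + 2 * tp * Real.cos (kltpPairKY tp μ p (w + u) u)) +
        2 * Real.sin (kltpPairKX tp μ p (w + u) u) *
          (2 * tp * (-Real.sin (kltpPairKY tp μ p (w + u) u) * (kltpVY tp μ (w + u) + kltpVY tp μ u)))) u :=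
    (hX.sin.const_mul 2).mul ((hY.cos.const_mul (2 * tp)).const_add 1)
  have hdy : HasDerivAt (fun t => 2 * Real.sin (kltpPairKY tp μ p (w + t) t) * (1 + 2 * tp * Real.cos (kltpPairKX tp μ p (w + t) t)))
      (2 * (Real.cos (kltpPairKY tp μ p (w + u) u) * (kltpVY tp μ (w + u) + kltpVY tp μ u)) *
          (1 + 2 * tp * Real.cos (kltpPairKX tp μ p (w + u) u)) +
        2 * Real.sin (kltpPairKY tp μ p (w + u) u) *
          (2 * tp * (-Real.sin (kltpPairKX tp μ p (w + u) u) * (kltpVX tp μ (w + u) + kltpVX tp μ u)))) u :=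
    (hY.sin.const_mul 2).mul ((hX.cos.const_mul (2 * tp)).const_add 1)
  have h := (hdx.mul hsx).add (hdy.mul hsy)
  refine h.congr_deriv ?_
  simp only [kltpPairEdd, kltpPairE₁₁, kltpPairE₁₂, kltpPairE₂₂, dx, dy, dxx, dyy, dxy]; ring

/-! ### Joint continuity in `(p, θ, φ)` -/

/-- **Joint continuity of the pair energy and its slice derivatives** in `z = (p, θ, φ)`. [folklore] -/
theorem continuous_kltpPairE_all :
    Continuous (fun z : (ℝ × ℝ) × ℝ × ℝ => kltpPairE tp μ z.1 z.2.1 z.2.2) ∧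
    Continuous (fun z : (ℝ × ℝ) × ℝ × ℝ => kltpPairE₁ tp μ z.1 z.2.1 z.2.2) ∧
    Continuous (fun z : (ℝ × ℝ) × ℝ × ℝ => kltpPairE₂ tp μ z.1 z.2.1 z.2.2) ∧
    Continuous (fun z : (ℝ × ℝ) × ℝ × ℝ => kltpPairE₁₁ tp μ z.1 z.2.1 z.2.2) ∧
    Continuous (fun z : (ℝ × ℝ) × ℝ × ℝ => kltpPairE₂₂ tp μ z.1 z.2.1 z.2.2) ∧
    Continuous (fun z : (ℝ × ℝ) × ℝ × ℝ => kltpPairEdd tp μ z.1 z.2.1 z.2.2) := by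
  obtain ⟨hx, hy, hvx, hvy, hax, hay⟩ := continuous_kltpFrame htp hμ₁ hμ₂
  have KX : Continuous (fun z : (ℝ × ℝ) × ℝ × ℝ => kltpPairKX tp μ z.1 z.2.1 z.2.2) := by
    unfold kltpPairKX; fun_prop
  have KY : Continuous (fun z : (ℝ × ℝ) × ℝ × ℝ => kltpPairKY tp μ z.1 z.2.1 z.2.2) := by
    unfold kltpPairKY; fun_prop
  have E1 : Continuous (fun z : (ℝ × ℝ) × ℝ × ℝ => kltpPairE₁ tp μ z.1 z.2.1 z.2.2) := by
    unfold kltpPairE₁ dx dy; fun_prop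
  have E2 : Continuous (fun z : (ℝ × ℝ) × ℝ × ℝ => kltpPairE₂ tp μ z.1 z.2.1 z.2.2) := by
    unfold kltpPairE₂ dx dy; fun_prop
  have E11 : Continuous (fun z : (ℝ × ℝ) × ℝ × ℝ => kltpPairE₁₁ tp μ z.1 z.2.1 z.2.2) := by
    unfold kltpPairE₁₁ dx dy dxx dyy dxy; fun_prop
  have E22 : Continuous (fun z : (ℝ × ℝ) × ℝ × ℝ => kltpPairE₂₂ tp μ z.1 z.2.1 z.2.2) := by
    unfold kltpPairE₂₂ dx dy dxx dyy dxy; fun_prop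
  have E12 : Continuous (fun z : (ℝ × ℝ) × ℝ × ℝ => kltpPairE₁₂ tp μ z.1 z.2.1 z.2.2) := by
    unfold kltpPairE₁₂ dxx dyy dxy; fun_prop
  refine ⟨?_, E1, E2, E11, E22, ?_⟩
  · unfold kltpPairE; fun_prop
  · unfold kltpPairEdd
    exact (E11.add (continuous_const.mul E12)).add E22

/-- The pair energy is jointly continuous in `(θ, φ)` at fixed `p`. [folklore] -/
theorem continuous_kltpPairE_uncurry (p : ℝ × ℝ) : Continuous fun z : ℝ × ℝ => kltpPairE tp μ p z.1 z.2 := by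
  obtain ⟨hx, hy, -, -, -, -⟩ := continuous_kltpFrame htp hμ₁ hμ₂
  unfold kltpPairE kltpPairKX kltpPairKY
  fun_prop

/-- `kltpPairE₁`, `kltpPairE₁₁` are continuous in `θ`; `kltpPairE₂`, `kltpPairE₂₂` in `φ`; and the diagonal quantities along the diagonal. [folklore] -/
theorem continuous_kltpPairE_derivs (p : ℝ × ℝ) :
    (∀ φ, Continuous fun θ => kltpPairE₁ tp μ p θ φ) ∧ (∀ φ, Continuous fun θ => kltpPairE₁₁ tp μ p θ φ) ∧
    (∀ θ, Continuous fun φ => kltpPairE₂ tp μ p θ φ) ∧ (∀ θ, Continuous fun φ => kltpPairE₂₂ tp μ p θ φ) ∧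
    (∀ w, Continuous fun u => kltpPairE₁ tp μ p (w + u) u + kltpPairE₂ tp μ p (w + u) u) ∧
    (∀ w, Continuous fun u => kltpPairEdd tp μ p (w + u) u) := by
  obtain ⟨hx, hy, hvx, hvy, hax, hay⟩ := continuous_kltpFrame htp hμ₁ hμ₂
  refine ⟨fun φ => ?_, fun φ => ?_, fun θ => ?_, fun θ => ?_, fun w => ?_, fun w => ?_⟩ <;>
    simp only [kltpPairEdd, kltpPairE₁, kltpPairE₂, kltpPairE₁₁, kltpPairE₂₂, kltpPairE₁₂, kltpPairKX, kltpPairKY,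
      dx, dy, dxx, dyy, dxy] <;>
    fun_prop

end Window

/-! ### Periodicity in `p` and reduction into the period square -/

/-- The pair energy and its derivatives are `2π`-periodic in each component of `p`. [folklore] -/
theorem kltpPairE_all_periodic (tp μ : ℝ) (p : ℝ × ℝ) (m n : ℤ) (θ φ : ℝ) :
    kltpPairE tp μ (p.1 + m * (2 * π), p.2 + n * (2 * π)) θ φ = kltpPairE tp μ p θ φ ∧
    kltpPairE₁ tp μ (p.1 + m * (2 * π), p.2 + n * (2 * π)) θ φ = kltpPairE₁ tp μ p θ φ ∧
    kltpPairE₂ tp μ (p.1 + m * (2 * π), p.2 + n * (2 * π)) θ φ = kltpPairE₂ tp μ p θ φ ∧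
    kltpPairE₁₁ tp μ (p.1 + m * (2 * π), p.2 + n * (2 * π)) θ φ = kltpPairE₁₁ tp μ p θ φ ∧
    kltpPairE₂₂ tp μ (p.1 + m * (2 * π), p.2 + n * (2 * π)) θ φ = kltpPairE₂₂ tp μ p θ φ ∧
    kltpPairEdd tp μ (p.1 + m * (2 * π), p.2 + n * (2 * π)) θ φ = kltpPairEdd tp μ p θ φ := by
  have hX : kltpPairKX tp μ (p.1 + m * (2 * π), p.2 + n * (2 * π)) θ φ = kltpPairKX tp μ p θ φ + m * (2 * π) := by
    simp only [kltpPairKX]; ring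
  have hY : kltpPairKY tp μ (p.1 + m * (2 * π), p.2 + n * (2 * π)) θ φ = kltpPairKY tp μ p θ φ + n * (2 * π) := by
    simp only [kltpPairKY]; ring
  have hc1 := Real.cos_add_int_mul_two_pi (kltpPairKX tp μ p θ φ) m
  have hs1 := Real.sin_add_int_mul_two_pi (kltpPairKX tp μ p θ φ) m
  have hc2 := Real.cos_add_int_mul_two_pi (kltpPairKY tp μ p θ φ) n
  have hs2 := Real.sin_add_int_mul_two_pi (kltpPairKY tp μ p θ φ) n
  simp only [kltpPairEdd, kltpPairE, kltpPairE₁, kltpPairE₂, kltpPairE₁₁, kltpPairE₂₂, kltpPairE₁₂, dx, dy, dxx, dyy, dxy,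
    hX, hY, hc1, hs1, hc2, hs2, and_self]

/-- Reduction of `p` modulo `2π` into `[−π, π]²` does not change the six quantities. [folklore] -/
theorem kltpPairE_all_reduce (tp μ : ℝ) (p : ℝ × ℝ) :
    ∃ q : ℝ × ℝ, q ∈ Icc (-π) π ×ˢ Icc (-π) π ∧ ∀ θ φ : ℝ,
      kltpPairE tp μ q θ φ = kltpPairE tp μ p θ φ ∧ kltpPairE₁ tp μ q θ φ = kltpPairE₁ tp μ p θ φ ∧
      kltpPairE₂ tp μ q θ φ = kltpPairE₂ tp μ p θ φ ∧ kltpPairE₁₁ tp μ q θ φ = kltpPairE₁₁ tp μ p θ φ ∧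
      kltpPairE₂₂ tp μ q θ φ = kltpPairE₂₂ tp μ p θ φ ∧ kltpPairEdd tp μ q θ φ = kltpPairEdd tp μ p θ φ := by
  set m : ℤ := -toIocDiv Real.two_pi_pos (-π) p.1 with hm
  set n : ℤ := -toIocDiv Real.two_pi_pos (-π) p.2 with hn
  have h1 : toIocMod Real.two_pi_pos (-π) p.1 = p.1 + m * (2 * π) := by
    rw [hm, toIocMod, zsmul_eq_mul]; push_cast; ring
  have h2 : toIocMod Real.two_pi_pos (-π) p.2 = p.2 + n * (2 * π) := by
    rw [hn, toIocMod, zsmul_eq_mul]; push_cast; ring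
  have hm1 := toIocMod_mem_Ioc Real.two_pi_pos (-π) p.1
  have hm2 := toIocMod_mem_Ioc Real.two_pi_pos (-π) p.2
  refine ⟨(p.1 + m * (2 * π), p.2 + n * (2 * π)), ?_, fun θ φ => kltpPairE_all_periodic tp μ p m n θ φ⟩
  rw [← h1, ← h2]
  exact ⟨⟨hm1.1.le, by linarith [hm1.2]⟩, ⟨hm2.1.le, by linarith [hm2.2]⟩⟩

end Summit.HubbardSuperconductivity.HubbardSuperconductivity.Theorems

end
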